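import Summits.FinalStateConjecture.FinalStateConjecture.Theorems.PhotonSphereChannelsEnergyInequalities

/-!
# Route PhotonSphereChannels — exterior (channel) energies of Regge–Wheeler solutions are monotone in `|t|`

Third file of the energy–flux calculus (`PhotonSphereChannelsEnergyIdentity`,
`PhotonSphereChannelsEnergyInequalities`).  It translates the Fréchet-partial statements on
`ℝ × ℝ` into the exact vocabulary of the route decls `UniformPhotonSphereChannels` (item
stmt-FinalStateConjecture-10045), `FixedModeChannels` and `BlindnessInsidePhotonSphere` of
`Summits/FinalStateConjecture/FinalStateConjecture/Theses/PhotonSphereChannels.lean`, which speak of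
curried `ψ : ℝ → ℝ → ℝ` with `ContDiff ℝ 2 (Function.uncurry ψ)`, first derivatives
`deriv (fun τ => ψ τ x) t`, `deriv (ψ t) x`, second derivatives `iteratedDeriv 2` of slices, the
Regge–Wheeler potential `V_{s,ℓ}(x) = (1 − 2M/r x)(ℓ(ℓ+1)/r x² + (1 − s²)·2M/r x³)` along a radius
function `r > 2M`, `r' = 1 − 2M/r`, and exterior energies
`Eext t = ∫⁻ x in {x | ρ + |t| < |x − x_c|}, ofReal (ψ_t² + ψ_x² + V ψ²)`.

Main results:
* `deriv_slice_fst_eq`, `deriv_slice_snd_eq`, `iteratedDeriv_two_slice_fst_eq`,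
  `iteratedDeriv_two_slice_snd_eq`: the dictionary `deriv`/`iteratedDeriv 2` ↔ `fderiv`;
* `differentiable_reggeWheeler`, `reggeWheeler_pos`: `V_{s,ℓ} ∘ r` is differentiable and positive
  for all `s ≤ ℓ` (so the items' energy densities are non-negative and the `V ≥ 0` calculus
  applies; the hypotheses `r x_c = 3M`, `s ≤ 2` of the items are not needed for this);
* `reggeWheeler_exteriorEnergy_mono_abs`: for every `C²` solution of the items' equation
  (`IsSol` at every point) and every `ρ ≥ 0`, `Eext t₂ ≤ Eext t₁` whenever `|t₁| ≤ |t₂|` and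
  `t₁ t₂ ≥ 0`;
* consequences for any `|t|`-monotone `E : ℝ → ℝ≥0∞` (`channel_*`): `E t ≤ E 0`, antitone on
  `t ≥ 0`, monotone on `t ≤ 0`, `liminf_{±∞} E` are limits and equal `⨅_{t ≥ 0} E`, `⨅_{t ≤ 0} E`,
  and `liminf_{+∞} E + liminf_{−∞} E ≤ E T₊ + E T₋ ≤ 2 E 0` for all finite `T₋ ≤ 0 ≤ T₊`.

For item stmt-FinalStateConjecture-10045 this is the formal content of "Lemma A" of the attached
refutation notes (the right-hand side of `UniformPhotonSphereChannels` is controlled by exterior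
energies at any finite pair of times, so a counterexample only needs finite-time estimates); for
`FixedModeChannels` it is the standard first step (channel energies exist as monotone limits).
No new definitions; standard material [folklore].
-/

namespace Summit.FinalStateConjecture.FinalStateConjecture.Theorems

open MeasureTheory Set Filter Topology intervalIntegral

noncomputable section

namespace WaveEnergy

variable {u : ℝ × ℝ → ℝ} {V : ℝ → ℝ}

/-! ### Translation to curried functions `ψ : ℝ → ℝ → ℝ` with `deriv` / `iteratedDeriv` -/

/-- `deriv` of a `t`-slice of a curried `C²` function is the Fréchet partial `∂(uncurry ψ)(t,x)(1,0)`. -/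
theorem deriv_slice_fst_eq {ψ : ℝ → ℝ → ℝ} (hψ : ContDiff ℝ 2 (Function.uncurry ψ)) (t x : ℝ) :
    deriv (fun τ => ψ τ x) t = fderiv ℝ (Function.uncurry ψ) (t, x) (1, 0) :=
  (hasDerivAt_slice_fst (differentiable_of_contDiff_two hψ) t x).deriv

/-- `deriv` of an `x`-slice of a curried `C²` function is the Fréchet partial `∂(uncurry ψ)(t,x)(0,1)`. -/
theorem deriv_slice_snd_eq {ψ : ℝ → ℝ → ℝ} (hψ : ContDiff ℝ 2 (Function.uncurry ψ)) (t x : ℝ) :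
    deriv (ψ t) x = fderiv ℝ (Function.uncurry ψ) (t, x) (0, 1) :=
  (hasDerivAt_slice_snd (differentiable_of_contDiff_two hψ) t x).deriv

/-- `iteratedDeriv 2` of a `t`-slice of a curried `C²` function is the second Fréchet partial
`∂²(uncurry ψ)(t,x)(1,0)(1,0)`. -/
theorem iteratedDeriv_two_slice_fst_eq {ψ : ℝ → ℝ → ℝ} (hψ : ContDiff ℝ 2 (Function.uncurry ψ))
    (t x : ℝ) :
    iteratedDeriv 2 (fun τ => ψ τ x) t
      = fderiv ℝ (fderiv ℝ (Function.uncurry ψ)) (t, x) (1, 0) (1, 0) := by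
  rw [iteratedDeriv_succ, iteratedDeriv_one]
  have h1 : deriv (fun τ => ψ τ x) = fun τ => fderiv ℝ (Function.uncurry ψ) (τ, x) (1, 0) :=
    funext fun τ => deriv_slice_fst_eq hψ τ x
  rw [h1]
  exact (hasDerivAt_fderiv_apply_slice_fst hψ (1, 0) t x).deriv

/-- `iteratedDeriv 2` of an `x`-slice of a curried `C²` function is the second Fréchet partial
`∂²(uncurry ψ)(t,x)(0,1)(0,1)`. -/
theorem iteratedDeriv_two_slice_snd_eq {ψ : ℝ → ℝ → ℝ} (hψ : ContDiff ℝ 2 (Function.uncurry ψ))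
    (t x : ℝ) :
    iteratedDeriv 2 (ψ t) x = fderiv ℝ (fderiv ℝ (Function.uncurry ψ)) (t, x) (0, 1) (0, 1) := by
  rw [iteratedDeriv_succ, iteratedDeriv_one]
  have h1 : deriv (ψ t) = fun y => fderiv ℝ (Function.uncurry ψ) (t, y) (0, 1) :=
    funext fun y => deriv_slice_snd_eq hψ t y
  rw [h1]
  exact (hasDerivAt_fderiv_apply_slice_snd hψ (0, 1) t x).deriv

/-- **Monotonicity of the two-ended exterior energy in `|t|`, curried form.** For a `C²` function
`ψ : ℝ → ℝ → ℝ` solving `ψ_tt − ψ_xx + V(x) ψ = 0` everywhere (second derivatives as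
`iteratedDeriv 2` of slices, exactly as in the route decls), `V ≥ 0` differentiable, `0 ≤ ρ`, and
times of one sign with `|t₁| ≤ |t₂|`:
`∫⁻_{ρ+|t₂|<|x−x_c|} (ψ_t² + ψ_x² + Vψ²)(t₂,·) ≤ ∫⁻_{ρ+|t₁|<|x−x_c|} (ψ_t² + ψ_x² + Vψ²)(t₁,·)`,
with `ψ_t = deriv (fun τ => ψ τ x) t`, `ψ_x = deriv (ψ t) x` as in the route. [folklore] -/
theorem exteriorEnergy_mono_abs_curried {V : ℝ → ℝ} (hV : Differentiable ℝ V) (hV0 : ∀ x, 0 ≤ V x)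
    {ψ : ℝ → ℝ → ℝ} (hψ : ContDiff ℝ 2 (Function.uncurry ψ))
    (hsol : ∀ t x : ℝ, iteratedDeriv 2 (fun τ => ψ τ x) t - iteratedDeriv 2 (ψ t) x + V x * ψ t x = 0)
    (xc : ℝ) {ρ : ℝ} (hρ : 0 ≤ ρ) {t₁ t₂ : ℝ} (habs : |t₁| ≤ |t₂|) (hsign : 0 ≤ t₁ * t₂) :
    ∫⁻ x in {x : ℝ | ρ + |t₂| < |x - xc|}, ENNReal.ofReal
        (deriv (fun τ => ψ τ x) t₂ ^ 2 + deriv (ψ t₂) x ^ 2 + V x * ψ t₂ x ^ 2)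
      ≤ ∫⁻ x in {x : ℝ | ρ + |t₁| < |x - xc|}, ENNReal.ofReal
        (deriv (fun τ => ψ τ x) t₁ ^ 2 + deriv (ψ t₁) x ^ 2 + V x * ψ t₁ x ^ 2) := by
  have hsol' : ∀ z : ℝ × ℝ, fderiv ℝ (fderiv ℝ (Function.uncurry ψ)) z (1, 0) (1, 0)
      - fderiv ℝ (fderiv ℝ (Function.uncurry ψ)) z (0, 1) (0, 1)
      + V z.2 * Function.uncurry ψ z = 0 := by
    rintro ⟨t, x⟩
    rw [← iteratedDeriv_two_slice_fst_eq hψ, ← iteratedDeriv_two_slice_snd_eq hψ]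
    exact hsol t x
  have he : ∀ z : ℝ × ℝ, (fun z : ℝ × ℝ =>
      deriv (fun τ => ψ τ z.2) z.1 ^ 2 + deriv (ψ z.1) z.2 ^ 2 + V z.2 * ψ z.1 z.2 ^ 2) z
      = (fderiv ℝ (Function.uncurry ψ) z (1, 0)) ^ 2 + (fderiv ℝ (Function.uncurry ψ) z (0, 1)) ^ 2
        + V z.2 * Function.uncurry ψ z ^ 2 := by
    rintro ⟨t, x⟩
    simp only [Function.uncurry_apply_pair]
    rw [deriv_slice_fst_eq hψ, deriv_slice_snd_eq hψ]
  exact exteriorEnergy_mono_abs hψ hV hV0 hsol' he xc hρ habs hsign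

/-! ### The Regge–Wheeler potential along a tortoise radius function -/

/-- The Regge–Wheeler potential `V_{s,ℓ}(x) = (1 − 2M/r)(ℓ(ℓ+1)/r² + (1 − s²)·2M/r³)` along any
differentiable radius function `r > 2M` is differentiable. -/
theorem differentiable_reggeWheeler {M : ℝ} {r : ℝ → ℝ} (hr : ∀ x, 2 * M < r x) (hM : 0 < M)
    (hr' : ∀ x, HasDerivAt r (1 - 2 * M / r x) x) (s ℓ : ℕ) :
    Differentiable ℝ (fun x => (1 - 2 * M / r x)
      * ((ℓ : ℝ) * ((ℓ : ℝ) + 1) / r x ^ 2 + (1 - (s : ℝ) ^ 2) * (2 * M) / r x ^ 3)) := by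
  have hrd : Differentiable ℝ r := fun x => (hr' x).differentiableAt
  have hr0 : ∀ x, r x ≠ 0 := fun x => by
    have := hr x
    exact (by linarith : (0 : ℝ) < r x).ne'
  have h2 : ∀ x, r x ^ 2 ≠ 0 := fun x => pow_ne_zero 2 (hr0 x)
  have h3 : ∀ x, r x ^ 3 ≠ 0 := fun x => pow_ne_zero 3 (hr0 x)
  refine ((differentiable_const _).sub ((differentiable_const _).div hrd hr0)).mul ?_
  exact ((differentiable_const _).div (hrd.pow 2) h2).add
    ((differentiable_const _).div (hrd.pow 3) h3)

/-- The Regge–Wheeler potential is positive along any radius function `r > 2M` (`M > 0`) for all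
`s ≤ ℓ`: `ℓ(ℓ+1) r + 2M(1 − s²) ≥ s(s+1)·2M + 2M − 2Ms² = 2M(s+1) > 0`. -/
theorem reggeWheeler_pos {M : ℝ} {r : ℝ → ℝ} (hr : ∀ x, 2 * M < r x) (hM : 0 < M)
    {s ℓ : ℕ} (hsl : s ≤ ℓ) (x : ℝ) :
    0 < (1 - 2 * M / r x)
      * ((ℓ : ℝ) * ((ℓ : ℝ) + 1) / r x ^ 2 + (1 - (s : ℝ) ^ 2) * (2 * M) / r x ^ 3) := by
  have hrx : 0 < r x := by linarith [hr x]
  have h1 : 0 < 1 - 2 * M / r x := by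
    rw [sub_pos, div_lt_one hrx]
    exact hr x
  have hsl' : (s : ℝ) ≤ ℓ := Nat.cast_le.mpr hsl
  have hs0 : (0 : ℝ) ≤ s := Nat.cast_nonneg s
  have hA : 0 ≤ ((ℓ : ℝ) * ((ℓ : ℝ) + 1) - (s : ℝ) * ((s : ℝ) + 1)) * r x :=
    mul_nonneg (by nlinarith) hrx.le
  have hB : 0 ≤ (s : ℝ) * ((s : ℝ) + 1) * (r x - 2 * M) :=
    mul_nonneg (by positivity) (by linarith [hr x])
  have hC : 0 ≤ M * s := mul_nonneg hM.le hs0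
  have hnum : 0 < (ℓ : ℝ) * ((ℓ : ℝ) + 1) * r x + (1 - (s : ℝ) ^ 2) * (2 * M) := by nlinarith
  have heq : (ℓ : ℝ) * ((ℓ : ℝ) + 1) / r x ^ 2 + (1 - (s : ℝ) ^ 2) * (2 * M) / r x ^ 3
      = ((ℓ : ℝ) * ((ℓ : ℝ) + 1) * r x + (1 - (s : ℝ) ^ 2) * (2 * M)) / r x ^ 3 := by
    field_simp
  rw [heq]
  exact mul_pos h1 (div_pos hnum (pow_pos hrx 3))

/-- **The two-ended exterior Regge–Wheeler energy is monotone in `|t|`** — in the exact vocabulary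
of the route decls `UniformPhotonSphereChannels` / `FixedModeChannels` (route PhotonSphereChannels):
for `M > 0`, any radius function `r > 2M` with `r' = 1 − 2M/r`, any `s ≤ ℓ`, any `ρ ≥ 0`, and any
`C²` solution `ψ` of `ψ_tt − ψ_xx + V_{s,ℓ}(r(x)) ψ = 0` (the items' `IsSol` at every point), the
items' exterior energy `Eext t = ∫⁻_{ρ+|t|<|x−x_c|} (ψ_t² + ψ_x² + Vψ²)(t,·)` satisfies
`Eext t₂ ≤ Eext t₁` whenever `|t₁| ≤ |t₂|` and `t₁ t₂ ≥ 0`.  (The normalisation `r x_c = 3M` and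
`s ≤ 2` are not needed.) [folklore] -/
theorem reggeWheeler_exteriorEnergy_mono_abs {M : ℝ} (hM : 0 < M) {r : ℝ → ℝ}
    (hr : ∀ x, 2 * M < r x) (hr' : ∀ x, HasDerivAt r (1 - 2 * M / r x) x) {s ℓ : ℕ} (hsl : s ≤ ℓ)
    (xc : ℝ) {ρ : ℝ} (hρ : 0 ≤ ρ) {ψ : ℝ → ℝ → ℝ} (hψ : ContDiff ℝ 2 (Function.uncurry ψ))
    (hsol : ∀ z : ℝ × ℝ, iteratedDeriv 2 (fun τ => ψ τ z.2) z.1 - iteratedDeriv 2 (ψ z.1) z.2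
      + (1 - 2 * M / r z.2) * ((ℓ : ℝ) * ((ℓ : ℝ) + 1) / r z.2 ^ 2
        + (1 - (s : ℝ) ^ 2) * (2 * M) / r z.2 ^ 3) * ψ z.1 z.2 = 0)
    {t₁ t₂ : ℝ} (habs : |t₁| ≤ |t₂|) (hsign : 0 ≤ t₁ * t₂) :
    ∫⁻ x in {x : ℝ | ρ + |t₂| < |x - xc|}, ENNReal.ofReal
        (deriv (fun τ => ψ τ x) t₂ ^ 2 + deriv (ψ t₂) x ^ 2
          + (1 - 2 * M / r x) * ((ℓ : ℝ) * ((ℓ : ℝ) + 1) / r x ^ 2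
            + (1 - (s : ℝ) ^ 2) * (2 * M) / r x ^ 3) * ψ t₂ x ^ 2)
      ≤ ∫⁻ x in {x : ℝ | ρ + |t₁| < |x - xc|}, ENNReal.ofReal
        (deriv (fun τ => ψ τ x) t₁ ^ 2 + deriv (ψ t₁) x ^ 2
          + (1 - 2 * M / r x) * ((ℓ : ℝ) * ((ℓ : ℝ) + 1) / r x ^ 2
            + (1 - (s : ℝ) ^ 2) * (2 * M) / r x ^ 3) * ψ t₁ x ^ 2) :=
  exteriorEnergy_mono_abs_curried (differentiable_reggeWheeler hr hM hr' s ℓ)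
    (fun x => (reggeWheeler_pos hr hM hsl x).le) hψ (fun t x => hsol (t, x)) xc hρ habs hsign

/-! ### Consequences of `|t|`-monotonicity for the channel energies `liminf_{t → ±∞} Eext` -/

section Channel

variable {E : ℝ → ENNReal}

/-- A `|t|`-monotone exterior energy is maximal at `t = 0`. -/
theorem channel_le_zero_time (hE : ∀ ⦃t₁ t₂ : ℝ⦄, |t₁| ≤ |t₂| → 0 ≤ t₁ * t₂ → E t₂ ≤ E t₁)
    (t : ℝ) : E t ≤ E 0 :=
  hE (by simp) (by simp)

/-- A `|t|`-monotone exterior energy is non-increasing on `t ≥ 0`. -/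
theorem channel_antitoneOn (hE : ∀ ⦃t₁ t₂ : ℝ⦄, |t₁| ≤ |t₂| → 0 ≤ t₁ * t₂ → E t₂ ≤ E t₁) :
    AntitoneOn E (Ici 0) := by
  intro a ha b hb hab
  exact hE (by rwa [abs_of_nonneg (mem_Ici.mp ha), abs_of_nonneg (mem_Ici.mp hb)])
    (mul_nonneg ha hb)

/-- A `|t|`-monotone exterior energy is non-decreasing on `t ≤ 0`. -/
theorem channel_monotoneOn (hE : ∀ ⦃t₁ t₂ : ℝ⦄, |t₁| ≤ |t₂| → 0 ≤ t₁ * t₂ → E t₂ ≤ E t₁) :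
    MonotoneOn E (Iic 0) := by
  intro a ha b hb hab
  exact hE (by rwa [abs_of_nonpos (mem_Iic.mp ha), abs_of_nonpos (mem_Iic.mp hb), neg_le_neg_iff])
    (mul_nonneg_of_nonpos_of_nonpos hb ha)

/-- The forward channel energy is bounded by the exterior energy at any finite time `T ≥ 0`:
`liminf_{t→+∞} E ≤ E T`. -/
theorem channel_liminf_atTop_le (hE : ∀ ⦃t₁ t₂ : ℝ⦄, |t₁| ≤ |t₂| → 0 ≤ t₁ * t₂ → E t₂ ≤ E t₁)
    {T : ℝ} (hT : 0 ≤ T) : liminf E atTop ≤ E T := by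
  refine liminf_le_of_frequently_le (Eventually.frequently ?_)
  filter_upwards [eventually_ge_atTop T] with t ht
  exact channel_antitoneOn hE (mem_Ici.mpr hT) (mem_Ici.mpr (hT.trans ht)) ht

/-- The backward channel energy is bounded by the exterior energy at any finite time `T ≤ 0`:
`liminf_{t→−∞} E ≤ E T`. -/
theorem channel_liminf_atBot_le (hE : ∀ ⦃t₁ t₂ : ℝ⦄, |t₁| ≤ |t₂| → 0 ≤ t₁ * t₂ → E t₂ ≤ E t₁)
    {T : ℝ} (hT : T ≤ 0) : liminf E atBot ≤ E T := by
  refine liminf_le_of_frequently_le (Eventually.frequently ?_)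
  filter_upwards [eventually_le_atBot T] with t ht
  exact channel_monotoneOn hE (mem_Iic.mpr (ht.trans hT)) (mem_Iic.mpr hT) ht

/-- The forward channel energy is a limit: `E t → ⨅_{t ≥ 0} E t` as `t → +∞`. -/
theorem channel_tendsto_atTop (hE : ∀ ⦃t₁ t₂ : ℝ⦄, |t₁| ≤ |t₂| → 0 ≤ t₁ * t₂ → E t₂ ≤ E t₁) :
    Tendsto E atTop (𝓝 (⨅ t ∈ Ici (0 : ℝ), E t)) := by
  set f : ℝ → ENNReal := fun t => E (max t 0) with hf
  have hfa : Antitone f := by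
    intro a b hab
    exact channel_antitoneOn hE (mem_Ici.mpr (le_max_right a 0)) (mem_Ici.mpr (le_max_right b 0))
      (max_le_max hab le_rfl)
  have hlim : Tendsto f atTop (𝓝 (⨅ t, f t)) := tendsto_atTop_iInf hfa
  have heq : (⨅ t, f t) = ⨅ t ∈ Ici (0 : ℝ), E t := by
    apply le_antisymm
    · refine le_iInf₂ fun t ht => ?_
      have : f t = E t := by simp only [hf, max_eq_left (mem_Ici.mp ht)]
      exact (iInf_le f t).trans this.le
    · refine le_iInf fun t => ?_
      exact iInf₂_le (max t 0) (mem_Ici.mpr (le_max_right t 0))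
  rw [← heq]
  refine hlim.congr' ?_
  filter_upwards [eventually_ge_atTop 0] with t ht
  simp only [hf, max_eq_left ht]

/-- The backward channel energy is a limit: `E t → ⨅_{t ≤ 0} E t` as `t → −∞`. -/
theorem channel_tendsto_atBot (hE : ∀ ⦃t₁ t₂ : ℝ⦄, |t₁| ≤ |t₂| → 0 ≤ t₁ * t₂ → E t₂ ≤ E t₁) :
    Tendsto E atBot (𝓝 (⨅ t ∈ Iic (0 : ℝ), E t)) := by
  set f : ℝ → ENNReal := fun t => E (min t 0) with hf
  have hfm : Monotone f := by
    intro a b hab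
    exact channel_monotoneOn hE (mem_Iic.mpr (min_le_right a 0)) (mem_Iic.mpr (min_le_right b 0))
      (min_le_min hab le_rfl)
  have hlim : Tendsto f atBot (𝓝 (⨅ t, f t)) := tendsto_atBot_iInf hfm
  have heq : (⨅ t, f t) = ⨅ t ∈ Iic (0 : ℝ), E t := by
    apply le_antisymm
    · refine le_iInf₂ fun t ht => ?_
      have : f t = E t := by simp only [hf, min_eq_left (mem_Iic.mp ht)]
      exact (iInf_le f t).trans this.le
    · refine le_iInf fun t => ?_
      exact iInf₂_le (min t 0) (mem_Iic.mpr (min_le_right t 0))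
  rw [← heq]
  refine hlim.congr' ?_
  filter_upwards [eventually_le_atBot 0] with t ht
  simp only [hf, min_eq_left ht]

/-- The forward channel energy equals the infimum of the exterior energies over `t ≥ 0`. -/
theorem channel_liminf_atTop_eq (hE : ∀ ⦃t₁ t₂ : ℝ⦄, |t₁| ≤ |t₂| → 0 ≤ t₁ * t₂ → E t₂ ≤ E t₁) :
    liminf E atTop = ⨅ t ∈ Ici (0 : ℝ), E t :=
  (channel_tendsto_atTop hE).liminf_eq

/-- The backward channel energy equals the infimum of the exterior energies over `t ≤ 0`. -/
theorem channel_liminf_atBot_eq (hE : ∀ ⦃t₁ t₂ : ℝ⦄, |t₁| ≤ |t₂| → 0 ≤ t₁ * t₂ → E t₂ ≤ E t₁) :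
    liminf E atBot = ⨅ t ∈ Iic (0 : ℝ), E t :=
  (channel_tendsto_atBot hE).liminf_eq

/-- **Finite times suffice.** The two-sided channel energy `liminf_{+∞} E + liminf_{−∞} E` of a
`|t|`-monotone exterior energy is bounded by `E T₊ + E T₋` for any finite `T₋ ≤ 0 ≤ T₊` — the
reduction of a channel-of-energy refutation to a finite-time energy estimate. -/
theorem channel_sum_liminf_le (hE : ∀ ⦃t₁ t₂ : ℝ⦄, |t₁| ≤ |t₂| → 0 ≤ t₁ * t₂ → E t₂ ≤ E t₁)
    {Tp Tm : ℝ} (hTp : 0 ≤ Tp) (hTm : Tm ≤ 0) :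
    liminf E atTop + liminf E atBot ≤ E Tp + E Tm :=
  add_le_add (channel_liminf_atTop_le hE hTp) (channel_liminf_atBot_le hE hTm)

/-- In particular the two-sided channel energy never exceeds twice the initial exterior energy. -/
theorem channel_sum_liminf_le_two_mul (hE : ∀ ⦃t₁ t₂ : ℝ⦄, |t₁| ≤ |t₂| → 0 ≤ t₁ * t₂ → E t₂ ≤ E t₁) :
    liminf E atTop + liminf E atBot ≤ 2 * E 0 := by
  rw [two_mul]
  exact channel_sum_liminf_le hE le_rfl le_rfl

end Channel

end WaveEnergy

end

end Summit.FinalStateConjecture.FinalStateConjecture.Theorems
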